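import Summits.Ventures.PercRepro.ProfilePointedCircuitClassesStarSharpPencilJ

/-!
# PercRepro — THE PENCIL THROUGH `ℓ ∈ X`, PART K: THE F-CLASS COUNT
(p5, gen 56; `proofs/P5-GM1.md` §83)

`pencilX_card_F_le`: the bad demands without `c1` are at most the C-targets on `P_f` plus the free bi-bases of the
F-class. Their pairs lie in `{ℓ} ∪ A` (`A` = the points of `X − ℓ` on `P_f`, `|A| ≤ 2`): with `A = {a, a′}` the three
candidates `{ℓ, a}`, `{ℓ, a′}`, `{a, a′}` are handled by parts H–J (a rich point gives two free bi-bases, a point on the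
line `eℓ` gives two C-points, two points on the line `ef` carry at most one demand).
-/

open scoped Matroid

namespace PercRepro.Cogirth

open Finset ThmH Skew Shadow Profile

open Classical

variable {α : Type} [DecidableEq α] {N : Matroid α} [N.Finite]

section StarSharpPencilK

variable {b b' : α}

/-- **THE F-CLASS COUNT**: the bad demands without `c1` are at most the C-targets on `P_f` plus the free bi-bases of
the F-class. -/
theorem pencilX_card_F_le (hn : (gr N).card = 9) (h : SeriesPair N b b') {e f : α} (he : e ∈ gr N)
    (hf : f ∈ gr N) (hef : e ≠ f) (heb : e ≠ b) (heb' : e ≠ b') (hfb : f ≠ b) (hfb' : f ≠ b')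
    (he1 : ∀ y ∈ ((((gr N).erase b).erase b').erase f).erase e, rk N {e, y} = 2)
    (hf1 : ∀ y ∈ ((((gr N).erase b).erase b').erase f).erase e, rk N {f, y} = 2)
    (hfc : ∀ y ∈ ((((gr N).erase b).erase b').erase f).erase e, rk N (((((gr N).erase b).erase b').erase f).erase y) = 4)
    (hX : rk N (((((gr N).erase b).erase b').erase f).erase e) = 4) (hef2 : rk N {e, f} = 2)
    (heb3 : rk N {e, b, b'} = 3)
    (hbg : ∀ y ∈ ((((gr N).erase b).erase b').erase f).erase e, rk N {y, b, b'} = 3)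
    {l : α} (hlX : l ∈ ((((gr N).erase b).erase b').erase f).erase e) (hlon : rk N (insert b (insert b' {e, l})) = 3)
    (hefl : rk N {e, f, l} = 3) :
    ((d0DON N b' e f).filter (fun W => (¬ d0c0 N b b' e f W ∧ ¬ (d0c1 N b e f W ∧ d0c2 N b b' e f W)) ∧
        ¬ d0c1 N b e f W)).card ≤
      ((biIndepSets N 4).filter (fun W => ((f ∈ W ∧ b' ∉ W) ∧ (e ∈ W ∧ b ∈ W)) ∧
        ¬ rk N (insert l (W.erase b)) = 4)).card +
      ((biIndepSets N 4).filter (fun B =>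
        (((f ∈ B ∧ b' ∉ B) ∧ (e ∈ B ∧ b ∉ B)) ∧
          ¬ (insert b (B.erase f) ∈ biIndepSets N 4 ∧ rk N (insert b (insert b' (B.erase f))) = 4)) ∧
        ¬ (l ∉ B ∧ ∀ z ∈ (B.erase e).erase f, rk N (insert f (insert e {l, z})) = 4))).card := by
  set X := ((((gr N).erase b).erase b').erase f).erase e with hXdef
  set A := X.filter (fun x => x ≠ l ∧ rk N (insert f (insert e {l, x})) ≤ 3) with hAdef
  set BF := (d0DON N b' e f).filter (fun W => (¬ d0c0 N b b' e f W ∧ ¬ (d0c1 N b e f W ∧ d0c2 N b b' e f W)) ∧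
        ¬ d0c1 N b e f W) with hBFdef
  set CT := (biIndepSets N 4).filter (fun W => ((f ∈ W ∧ b' ∉ W) ∧ (e ∈ W ∧ b ∈ W)) ∧
        ¬ rk N (insert l (W.erase b)) = 4) with hCTdef
  set FR := (biIndepSets N 4).filter (fun B =>
        (((f ∈ B ∧ b' ∉ B) ∧ (e ∈ B ∧ b ∉ B)) ∧
          ¬ (insert b (B.erase f) ∈ biIndepSets N 4 ∧ rk N (insert b (insert b' (B.erase f))) = 4)) ∧
        ¬ (l ∉ B ∧ ∀ z ∈ (B.erase e).erase f, rk N (insert f (insert e {l, z})) = 4)) with hFRdef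
  have hXg : X ⊆ gr N :=
    (erase_subset _ _).trans ((erase_subset _ _).trans ((erase_subset _ _).trans (erase_subset _ _)))
  have hefl_sub : ({e, f, l} : Finset α) ⊆ gr N :=
    insert_subset he (insert_subset hf (singleton_subset_iff.2 (hXg hlX)))
  -- the facts of a point of `A`
  have hAfacts : ∀ a ∈ A, a ∈ X ∧ a ≠ l ∧ rk N (insert a {e, f, l}) = 3 := by
    intro a ha
    rw [hAdef, mem_filter] at ha
    refine ⟨ha.1, ha.2.1, ?_⟩
    have h1 : rk N {e, f, l} ≤ rk N (insert f (insert e {l, a})) := by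
      rw [← insert_a_efl_eq]; exact rk_mono' (subset_insert _ _)
    rw [insert_a_efl_eq]
    rw [hefl] at h1
    have := ha.2.2
    omega
  have hAmem : ∀ x ∈ X, x ≠ l → rk N (insert x {e, f, l}) = 3 → x ∈ A := by
    intro x hxX hxl hxP
    rw [hAdef, mem_filter]
    refine ⟨hxX, hxl, ?_⟩
    rw [← insert_a_efl_eq, hxP]
  -- the members of the F-class
  have hmem : ∀ W ∈ BF, W ∈ d0DON N b' e f ∧ ¬ d0c0 N b b' e f W ∧ ¬ d0c1 N b e f W := by
    intro W hW
    rw [hBFdef, mem_filter] at hW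
    exact ⟨hW.1, hW.2.1.1, hW.2.2⟩
  have hstruct : ∀ W ∈ BF, ∃ π : Finset α, π ⊆ insert l A ∧ π.card = 2 ∧ W = insert b (insert e π) := by
    intro W hW
    exact pencilX_F_mem_structure hn h he hf hef heb heb' hfb hfb' he1 heb3 hlX hlon (hmem W hW).1 (hmem W hW).2.2
  -- the C-targets from C-points on `P_f`
  have hCT_l : rk N (X.erase l) = 4 → insert b {e, f, l} ∈ CT := by
    intro hY
    apply pencilX_F_cpoint_target_mem hn h he hf hef heb heb' hfb hfb' hlX hefl hY
    rw [insert_eq_of_mem (mem_insert_of_mem (mem_insert_of_mem (mem_singleton_self _))), hefl]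
  have hCT_a : ∀ a ∈ A, rk N {e, f, a} = 3 → rk N (X.erase a) = 4 → insert b {e, f, a} ∈ CT := by
    intro a ha hefa hY
    obtain ⟨haX, -, haP⟩ := hAfacts a ha
    apply pencilX_F_cpoint_target_mem hn h he hf hef heb heb' hfb hfb' haX hefa hY
    rw [insert_l_eft_eq, ← insert_a_efl_eq, haP]
  have hone : ∀ a ∈ A, ((rk N {e, f, l} = 3 ∧ rk N (X.erase l) = 4) ∨
      (rk N {e, f, a} = 3 ∧ rk N (X.erase a) = 4)) → 1 ≤ CT.card := by
    intro a ha hor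
    rcases hor with ⟨-, hY⟩ | ⟨hefa, hY⟩
    · exact card_pos.2 ⟨_, hCT_l hY⟩
    · exact card_pos.2 ⟨_, hCT_a a ha hefa hY⟩
  have htwo : ∀ a ∈ A, rk N (X.erase l) = 4 → rk N {e, f, a} = 3 → rk N (X.erase a) = 4 → 2 ≤ CT.card := by
    intro a ha hY hefa hYa
    obtain ⟨haX, hal, -⟩ := hAfacts a ha
    have hne : insert b ({e, f, l} : Finset α) ≠ insert b {e, f, a} := by
      intro heq
      have : a ∈ insert b ({e, f, l} : Finset α) := by
        rw [heq]; exact mem_insert_of_mem (mem_insert_of_mem (mem_insert_of_mem (mem_singleton_self _)))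
      simp only [mem_insert, mem_singleton] at this
      rcases this with h' | h' | h' | h'
      · exact (mem_erase.1 ((erase_subset _ _) ((erase_subset _ _) ((erase_subset _ _) haX)))).1 h'
      · exact (mem_erase.1 haX).1 h'
      · exact (mem_erase.1 (mem_erase.1 haX).2).1 h'
      · exact hal h'
    calc 2 = ({insert b ({e, f, l} : Finset α), insert b {e, f, a}} : Finset (Finset α)).card := (card_pair hne).symm
      _ ≤ CT.card := by
          apply card_le_card
          intro W hW
          simp only [mem_insert, mem_singleton] at hW
          rcases hW with rfl | rfl
          · exact hCT_l hY
          · exact hCT_a a ha hefa hYa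
  have hA2 : A.card ≤ 2 := pencilX_card_A_le_two hn h he hf hef heb heb' hfb hfb' hfc hlX hefl
  -- a demand `{ℓ, a} + e + b ∈ BF` is bad with `a ∉ L`
  have hla_facts : ∀ a ∈ A, insert b (insert e {l, a}) ∈ BF →
      insert b (insert e {l, a}) ∈ d0DON N b' e f ∧ ¬ d0c0 N b b' e f (insert b (insert e {l, a})) ∧
        rk N (insert e {l, a}) = 3 := by
    intro a ha hW
    obtain ⟨hWd, hc0, -⟩ := hmem _ hW
    exact ⟨hWd, hc0, (d0DON_pair_data hn h he hf hef heb heb' hfb hfb' hlX (hAfacts a ha).1 hWd).1⟩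
  have hefx_bound : ∀ x ∈ X, rk N {e, f, x} = 2 ∨ rk N {e, f, x} = 3 := by
    intro x hxX
    have h1 : rk N {e, f} ≤ rk N {e, f, x} := rk_mono' (pair_ef_subset_eft e f x)
    have h2 := rk_le_card' (M := N) ({e, f, x} : Finset α)
    have h3 := card_insert_le e ({f, x} : Finset α)
    have h4 := card_le_two (a := f) (b := x)
    rw [hef2] at h1
    omega
  rcases Nat.lt_or_ge A.card 1 with hA0 | hA1
  · -- `A = ∅`: no bad demand
    have hAe : A = ∅ := card_eq_zero.1 (by omega)
    have hBFe : BF = ∅ := by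
      rw [eq_empty_iff_forall_notMem]
      intro W hW
      obtain ⟨π, hπ, hπ2, -⟩ := hstruct W hW
      rw [hAe, insert_empty] at hπ
      have := card_le_card hπ
      rw [card_singleton, hπ2] at this
      omega
    rw [hBFe, card_empty]
    exact Nat.zero_le _
  rcases Nat.lt_or_ge A.card 2 with hA1' | hA2'
  · -- `A = {a}`: only the demand `{ℓ, a}`
    obtain ⟨a, hAa⟩ := card_eq_one.1 (by omega : A.card = 1)
    have ha : a ∈ A := by rw [hAa]; exact mem_singleton_self _
    obtain ⟨haX, hal, haP⟩ := hAfacts a ha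
    have hsub : BF ⊆ {insert b (insert e {l, a})} := by
      intro W hW
      obtain ⟨π, hπ, hπ2, rfl⟩ := hstruct W hW
      rw [hAa] at hπ
      have hπeq : π = {l, a} := eq_of_subset_of_card_le hπ (by rw [hπ2, card_pair hal.symm])
      rw [hπeq]; exact mem_singleton_self _
    have hB1 : BF.card ≤ 1 := by
      have := card_le_card hsub
      rwa [card_singleton] at this
    by_cases hWin : insert b (insert e {l, a}) ∈ BF
    · obtain ⟨hWd, hc0, -⟩ := hla_facts a ha hWin
      have := hone a ha (pencilX_F_la_cpoint hn h he hf hef heb heb' hfb hfb' he1 hf1 hfc hX hef2 hlX hlon hefl haX hal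
        haP hWd hc0)
      omega
    · have hBFe : BF = ∅ := by
        rw [eq_empty_iff_forall_notMem]
        intro W hW
        have := hsub hW
        rw [mem_singleton] at this
        exact hWin (this ▸ hW)
      rw [hBFe, card_empty]
      exact Nat.zero_le _
  · -- `A = {a, a′}`
    have hAc : A.card = 2 := by omega
    obtain ⟨a, a', haa', hAeq⟩ := card_eq_two.1 hAc
    have ha : a ∈ A := by rw [hAeq]; exact mem_insert_self _ _
    have ha' : a' ∈ A := by rw [hAeq]; exact mem_insert_of_mem (mem_singleton_self _)
    obtain ⟨haX, hal, haP⟩ := hAfacts a ha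
    obtain ⟨ha'X, ha'l, ha'P⟩ := hAfacts a' ha'
    have hAonly : ∀ x ∈ X, x ≠ l → rk N (insert x {e, f, l}) = 3 → x = a ∨ x = a' := by
      intro x hxX hxl hxP
      have := hAmem x hxX hxl hxP
      rw [hAeq] at this
      simp only [mem_insert, mem_singleton] at this
      exact this
    -- the three candidates
    have hcand : ∀ W ∈ BF, W = insert b (insert e {l, a}) ∨ W = insert b (insert e {l, a'}) ∨
        W = insert b (insert e {a, a'}) := by
      intro W hW
      obtain ⟨π, hπ, hπ2, rfl⟩ := hstruct W hW
      rw [hAeq] at hπ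
      rcases pair_of_subset_triple hπ hπ2 with rfl | rfl | rfl
      · exact Or.inl rfl
      · exact Or.inr (Or.inl rfl)
      · exact Or.inr (Or.inr rfl)
    -- the bad-demand facts of the candidates
    have haa'_facts : insert b (insert e {a, a'}) ∈ BF →
        insert b (insert e {a, a'}) ∈ d0DON N b' e f ∧ ¬ d0c0 N b b' e f (insert b (insert e {a, a'})) := by
      intro hW
      obtain ⟨hWd, hc0, -⟩ := hmem _ hW
      exact ⟨hWd, hc0⟩
    -- rich points give two free bi-bases
    have hrich : ∀ x ∈ A, ∀ x' ∈ A, x ≠ x' → rk N (insert e {l, x}) = 3 → rk N (insert e {l, x'}) = 3 →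
        rk N {e, f, x} = 3 → 2 ≤ FR.card := by
      intro x hx x' hx' hxx' hxL hx'L hefx
      obtain ⟨hxX, hxl, hxP⟩ := hAfacts x hx
      obtain ⟨hx'X, hx'l, hx'P⟩ := hAfacts x' hx'
      have hAonly' : ∀ z ∈ X, z ≠ l → rk N (insert z {e, f, l}) = 3 → z = x ∨ z = x' := by
        intro z hzX hzl hzP
        have := hAmem z hzX hzl hzP
        rw [hAeq] at this
        simp only [mem_insert, mem_singleton] at this
        rw [hAeq] at hx hx'
        simp only [mem_insert, mem_singleton] at hx hx'
        rcases this with rfl | rfl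
        · rcases hx with rfl | rfl
          · exact Or.inl rfl
          · rcases hx' with rfl | rfl
            · exact Or.inr rfl
            · exact absurd rfl hxx'
        · rcases hx with rfl | rfl
          · rcases hx' with rfl | rfl
            · exact absurd rfl hxx'
            · exact Or.inr rfl
          · exact Or.inl rfl
      exact pencilX_F_two_le_card_free_F hn h he hf hef heb heb' hfb hfb' he1 heb3 hbg hlX hlon hefl hxX hx'X hxx'
        hxl hx'l hxP hx'P hxL hx'L hefx hAonly'
    have hBF3 : BF.card ≤ 3 := by
      have hsub : BF ⊆ {insert b (insert e {l, a}), insert b (insert e {l, a'}), insert b (insert e {a, a'})} := by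
        intro W hW
        rcases hcand W hW with rfl | rfl | rfl
        · exact mem_insert_self _ _
        · exact mem_insert_of_mem (mem_insert_self _ _)
        · exact mem_insert_of_mem (mem_insert_of_mem (mem_singleton_self _))
      have := card_le_card hsub
      have h3 := card_le_three (a := insert b (insert e ({l, a} : Finset α))) (b := insert b (insert e {l, a'}))
        (c := insert b (insert e {a, a'}))
      omega
    have hBF_bound : ∀ (W₁ W₂ : Finset α), (∀ W ∈ BF, W = W₁ ∨ W = W₂) → BF.card ≤ 2 := by
      intro W₁ W₂ hW
      have hsub : BF ⊆ {W₁, W₂} := by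
        intro W hW'
        rcases hW W hW' with rfl | rfl
        · exact mem_insert_self _ _
        · exact mem_insert_of_mem (mem_singleton_self _)
      have := card_le_card hsub
      have h2 := card_le_two (a := W₁) (b := W₂)
      omega
    have hBF_bound1 : ∀ (W₁ : Finset α), (∀ W ∈ BF, W = W₁) → BF.card ≤ 1 := by
      intro W₁ hW
      have hsub : BF ⊆ {W₁} := by
        intro W hW'
        rw [hW W hW']; exact mem_singleton_self _
      have := card_le_card hsub
      rwa [card_singleton] at this
    have hFR2_la : insert b (insert e {l, a}) ∈ BF → insert b (insert e {l, a'}) ∈ BF → 2 ≤ FR.card := by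
      intro h₁ h₂
      obtain ⟨hW₁, hc0₁, haL⟩ := hla_facts a ha h₁
      obtain ⟨hW₂, hc0₂, ha'L⟩ := hla_facts a' ha' h₂
      rcases hefx_bound a haX with hefa | hefa
      · rcases hefx_bound a' ha'X with hefa' | hefa'
        · exact absurd (pencilX_F_not_both_la hn h he hf hef heb heb' hfb hfb' he1 hf1 hfc hlX hlon hefl haX ha'X
            haa' hal ha'l haP ha'P hefa hefa' hW₁ hc0₁ hW₂ hc0₂) id
        · exact hrich a' ha' a ha haa'.symm ha'L haL hefa'
      · exact hrich a ha a' ha' haa' haL ha'L hefa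
    by_cases h₁ : insert b (insert e {l, a}) ∈ BF <;> by_cases h₂ : insert b (insert e {l, a'}) ∈ BF <;>
      by_cases h₃ : insert b (insert e {a, a'}) ∈ BF
    · -- (1, 1, 1)
      obtain ⟨hW₁, hc0₁, -⟩ := hla_facts a ha h₁
      have hCT1 := hone a ha (pencilX_F_la_cpoint hn h he hf hef heb heb' hfb hfb' he1 hf1 hfc hX hef2 hlX hlon hefl
        haX hal haP hW₁ hc0₁)
      have hFR2 := hFR2_la h₁ h₂
      omega
    · -- (1, 1, 0)
      have hB2 : BF.card ≤ 2 := hBF_bound _ _ (fun W hW => by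
        rcases hcand W hW with rfl | rfl | rfl
        · exact Or.inl rfl
        · exact Or.inr rfl
        · exact absurd hW h₃)
      have hFR2 := hFR2_la h₁ h₂
      omega
    · -- (1, 0, 1)
      obtain ⟨hW₁, hc0₁, haL⟩ := hla_facts a ha h₁
      obtain ⟨hW₃, hc0₃⟩ := haa'_facts h₃
      have hB2 : BF.card ≤ 2 := hBF_bound _ _ (fun W hW => by
        rcases hcand W hW with rfl | rfl | rfl
        · exact Or.inl rfl
        · exact absurd hW h₂
        · exact Or.inr rfl)
      have ha'L_bound : rk N (insert e {l, a'}) = 2 ∨ rk N (insert e {l, a'}) = 3 := by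
        have h1 : rk N {e, l} ≤ rk N (insert e {l, a'}) := by
          rw [insert_e_lx_eq]; exact rk_mono' (subset_insert _ _)
        have h2 := rk_le_card' (M := N) (insert e ({l, a'} : Finset α))
        have h3 := card_insert_le e ({l, a'} : Finset α)
        have h4 := card_le_two (a := l) (b := a')
        rw [he1 l hlX] at h1
        omega
      rcases ha'L_bound with ha'L | ha'L
      · -- `a′` on the line `eℓ`: two C-points
        have hW₃' : insert b (insert e {a', a}) ∈ d0DON N b' e f := by rw [pair_comm']; exact hW₃
        have hc0₃' : ¬ d0c0 N b b' e f (insert b (insert e {a', a})) := by rw [pair_comm']; exact hc0₃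
        have hAonly' : ∀ z ∈ X, z ≠ l → rk N (insert z {e, f, l}) = 3 → z = a' ∨ z = a := by
          intro z hzX hzl hzP
          rcases hAonly z hzX hzl hzP with h' | h'
          · exact Or.inr h'
          · exact Or.inl h'
        obtain ⟨⟨-, hYl⟩, hefa', hYa'⟩ := pencilX_F_L_two_cpoints hn h he hf hef heb heb' hfb hfb' he1 hef2 hlX
          hlon hefl ha'X haX haa'.symm ha'l hal ha'P haP ha'L hAonly' hW₁ hc0₁ hW₃' hc0₃'
        have := htwo a' ha' hYl hefa' hYa'
        omega
      · -- `a′` off the line `eℓ`: a rich point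
        have hFR2 : 2 ≤ FR.card := by
          rcases hefx_bound a haX with hefa | hefa
          · rcases hefx_bound a' ha'X with hefa' | hefa'
            · exact absurd hW₃ (pencilX_F_not_aa'_of_line_ef hn h he hf hef heb heb' hfb hfb' hef2 haX ha'X hefa hefa')
            · exact hrich a' ha' a ha haa'.symm ha'L haL hefa'
          · exact hrich a ha a' ha' haa' haL ha'L hefa
        omega
    · -- (1, 0, 0)
      obtain ⟨hW₁, hc0₁, -⟩ := hla_facts a ha h₁
      have hB1 : BF.card ≤ 1 := hBF_bound1 _ (fun W hW => by
        rcases hcand W hW with rfl | rfl | rfl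
        · rfl
        · exact absurd hW h₂
        · exact absurd hW h₃)
      have := hone a ha (pencilX_F_la_cpoint hn h he hf hef heb heb' hfb hfb' he1 hf1 hfc hX hef2 hlX hlon hefl haX hal
        haP hW₁ hc0₁)
      omega
    · -- (0, 1, 1)
      obtain ⟨hW₂, hc0₂, ha'L⟩ := hla_facts a' ha' h₂
      obtain ⟨hW₃, hc0₃⟩ := haa'_facts h₃
      have hB2 : BF.card ≤ 2 := hBF_bound _ _ (fun W hW => by
        rcases hcand W hW with rfl | rfl | rfl
        · exact absurd hW h₁
        · exact Or.inl rfl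
        · exact Or.inr rfl)
      have haL_bound : rk N (insert e {l, a}) = 2 ∨ rk N (insert e {l, a}) = 3 := by
        have h1 : rk N {e, l} ≤ rk N (insert e {l, a}) := by
          rw [insert_e_lx_eq]; exact rk_mono' (subset_insert _ _)
        have h2 := rk_le_card' (M := N) (insert e ({l, a} : Finset α))
        have h3 := card_insert_le e ({l, a} : Finset α)
        have h4 := card_le_two (a := l) (b := a)
        rw [he1 l hlX] at h1
        omega
      rcases haL_bound with haL | haL
      · -- `a` on the line `eℓ`: two C-points
        obtain ⟨⟨-, hYl⟩, hefa, hYa⟩ := pencilX_F_L_two_cpoints hn h he hf hef heb heb' hfb hfb' he1 hef2 hlX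
          hlon hefl haX ha'X haa' hal ha'l haP ha'P haL hAonly hW₂ hc0₂ hW₃ hc0₃
        have := htwo a ha hYl hefa hYa
        omega
      · have hFR2 : 2 ≤ FR.card := by
          rcases hefx_bound a' ha'X with hefa' | hefa'
          · rcases hefx_bound a haX with hefa | hefa
            · exact absurd hW₃ (pencilX_F_not_aa'_of_line_ef hn h he hf hef heb heb' hfb hfb' hef2 haX ha'X hefa hefa')
            · exact hrich a ha a' ha' haa' haL ha'L hefa
          · exact hrich a' ha' a ha haa'.symm ha'L haL hefa'
        omega
    · -- (0, 1, 0)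
      obtain ⟨hW₂, hc0₂, -⟩ := hla_facts a' ha' h₂
      have hB1 : BF.card ≤ 1 := hBF_bound1 _ (fun W hW => by
        rcases hcand W hW with rfl | rfl | rfl
        · exact absurd hW h₁
        · rfl
        · exact absurd hW h₃)
      have := hone a' ha' (pencilX_F_la_cpoint hn h he hf hef heb heb' hfb hfb' he1 hf1 hfc hX hef2 hlX hlon hefl ha'X
        ha'l ha'P hW₂ hc0₂)
      omega
    · -- (0, 0, 1)
      obtain ⟨hW₃, hc0₃⟩ := haa'_facts h₃
      have hB1 : BF.card ≤ 1 := hBF_bound1 _ (fun W hW => by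
        rcases hcand W hW with rfl | rfl | rfl
        · exact absurd hW h₁
        · exact absurd hW h₂
        · rfl)
      have hCT1 : 1 ≤ CT.card := by
        rcases pencilX_F_aa'_cpoint hn h he hf hef heb heb' hfb hfb' he1 hf1 hfc hX hef2 hlX hlon hefl haX ha'X haa'
          haP ha'P hW₃ hc0₃ with ⟨hefa, hY⟩ | ⟨hefa', hY⟩
        · exact card_pos.2 ⟨_, hCT_a a ha hefa hY⟩
        · exact card_pos.2 ⟨_, hCT_a a' ha' hefa' hY⟩
      omega
    · -- (0, 0, 0)
      have hBFe : BF = ∅ := by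
        rw [eq_empty_iff_forall_notMem]
        intro W hW
        rcases hcand W hW with rfl | rfl | rfl
        · exact h₁ hW
        · exact h₂ hW
        · exact h₃ hW
      rw [hBFe, card_empty]
      exact Nat.zero_le _

end StarSharpPencilK

end PercRepro.Cogirth
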